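import Summits.BirchSwinnertonDyer.BirchSwinnertonDyer.Theorems.BiquadraticEisensteinDescentManinDatumSupercuspidalCMInertTorsionCoordinatesJZero
import Summits.BirchSwinnertonDyer.BirchSwinnertonDyer.Theorems.BiquadraticEisensteinDescentManinDatumSupercuspidalCMInertTorsionCoreOfResolventBound
import Mathlib.RingTheory.Algebraic.Integral
import HarnessLib

set_option linter.dupNamespace false -- `Summit.BirchSwinnertonDyer.BirchSwinnertonDyer.Theorems.…` (summit = sub, D-0017)
set_option autoImplicit false

/-!
# Crux `ManinDatumSupercuspidalCMInert` (stmt-BirchSwinnertonDyer-20111, BED r605), stub `stub_S5` (`j = 0` at `p = 5`) — EXPANSION +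
# PACKAGING: the algebraized `5`-torsion sum `Y(w)·Σ_d Φ(d)/(X(w) − X(t_d))` is `5^{(6−k)/6}`-divisible in the `5 ∤ s` currency as soon as
# the RESOLVENTS `R_n = Σ_d Φ(d)·X(t_d)⁻ⁿ` satisfy `v(R_n)⁶ ≤ v(5)^{6−k}` at every valuation above `5`

Route `BiquadraticEisensteinDescent` (cell `pub/bsd-wall`, width seat `bsd-wall-cm-bed-w1` g8; `--supports` stmt-BirchSwinnertonDyer-20111,
helper). THEOREMS ONLY (no definition, no named fact, no `sorry`); nothing is closed by this file and BSD is not proved by any of it.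

Third CM-side brick of `stub_S5`: the `ℤρ + ℤ` / `y² = x³ − 1` / `p = 5` twin of bed-w2 g10's `…TorsionCoreOfResolventBound`
(`val_coreSum_pow_four_le`, `coreSum_integral_of_resolventBound`), written GENERICALLY first:

* `val_mul_sum_div_sub_pow_le_of_resolventBound` — pure valuation algebra, ANY prime element `q` (`v q < 1`), ramification `e ≠ 0`, power `N ≠ 0`
  and target `d ≤ N`: for `v X ≤ 1`, `v Y ≤ 1`, weights `v Φ_i ≤ 1`, poles `X_i` with `X_i ≠ 0`, `v(X_i⁻¹)^e = v q` whenever `Φ_i ≠ 0`: if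
  `v(Σ_i Φ_i X_i⁻ⁿ)^N ≤ v(q)^d` for all `n ≥ 1` then `v(Y·Σ_i Φ_i/(X − X_i))^N ≤ v(q)^d` (geometric expansion
  `1/(X − X_i) = −Σ_{n<e} Xⁿπ_i^{n+1} + (Xπ_i)^e/(X − X_i)`, `π_i = X_i⁻¹`; tail terms have `v ≤ v(q)·v(π_i) < v q`). (`q = 7, e = 24, N = 4` is w2's
  lemma; `q = 5, e = 12, N = 6` is the `j = 0` cell.)
* `isAlgebraic_sum`, `exists_not_dvd_mul_isIntegral_of_isAlgebraic` — packaging WITHOUT division-polynomial bookkeeping: an ALGEBRAIC `z ∈ ℂ` with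
  `v z ≤ 1` at every valuation `v` with `v p < 1` has `s·z ∈ ℤ̄` for some `p ∤ s` (`IsAlgebraic.exists_integral_multiple` gives `m z ∈ ℤ̄`, `m ≠ 0`;
  split `m = pᵃ·N`, `p ∤ N`; `…SevenDivisionCurrency.exists_not_dvd_mul_isIntegral_of_forall_valuation`).
* `val_coreSum_pow_six_le_rho` — the `j = 0` instance: `w ∉ Λ = ℤρ + ℤ`, `M′w ∈ Λ`, `(M′,5) = 1`, `Φ : (ℤ/5)² → ℂ` with `Φ 0 = 0`, `v Φ ≤ 1`,
  `t_d = (d₁ρ + d₂)/5`, `k ≤ 6`: RES (`v(Σ_d Φ(d)X(t_d)⁻ⁿ)⁶ ≤ v 5^{6−k}` for `n ≥ 1`) ⇒ `v(Y(w)·Σ_d Φ(d)/(X(w) − X(t_d)))⁶ ≤ v 5^{6−k}`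
  (`X = ℘/ϖ₁²`, `Y = ℘′/(2ϖ₁³)`; inputs p641325 `val_weierstrassP_five_div_rho`, `…TorsionCoordinatesJZero.val_normalized_le_one_of_torsion_rho`).
* ★ `coreSum_integral_of_resolventBound_rho` — with `Φ` algebraic-integer valued and `1 ≤ k ≤ 5`: the resolvent bound at all `v ∣ 5` gives
  `∃ s, 5 ∤ s, s·(Y(w)·Σ_d Φ(d)/(X(w) − X(t_d)))/5^{(6−k)/6} ∈ ℤ̄` — the TERMWISE form of the would-be core `Core₅` of `stub_S5` once the torsion
  sum is algebraized (Literature `PeriodPair.sum_mul_eisensteinE₁_sub_eq_varpi_mul`, p641743) and a `ℤ[ω]` dictionary fixes `Φ = conj((·/5)₆)^k`.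

The resolvent bound itself (`RES₅(k)`, `k = v₅(B) ∈ {1,2,4,5}` for `y² = x³ + B`) is NOT proved here; it is certified EXACTLY as arithmetic by kit
job j310462 (memo `Cruxes/ManinDatumSupercuspidalCMInert/KIT-RES-CERT-w1g8.md`) and is the statement `…TameResolvent.resolvent_valuation_le` delivers
with `e = 24`, `j = 24 − 4k` once the `(ℤ[ω]/5)ˣ`-structure of `ℚ(ω)(E₀[5])` is in the tree. No definition, no named fact, no `sorry`.
-/

noncomputable section

open scoped Classical
open Complex PeriodPair
open Literature.NumberTheory.EllipticCurves

namespace Summit.BirchSwinnertonDyer.BirchSwinnertonDyer.Theorems.BiquadraticEisensteinDescentManinDatumSupercuspidalCMInertTorsionCoreOfResolventBoundJZero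

open Summit.BirchSwinnertonDyer.BirchSwinnertonDyer.Theorems.BiquadraticEisensteinDescentManinDatumSupercuspidalCMInertFormalChord
  (val_le_one_of_isIntegral)
open Summit.BirchSwinnertonDyer.BirchSwinnertonDyer.Theorems.BiquadraticEisensteinDescentManinDatumSupercuspidalCMInertSevenDivisionCurrency
  (exists_not_dvd_mul_isIntegral_of_forall_valuation)
open Summit.BirchSwinnertonDyer.BirchSwinnertonDyer.Theorems.BiquadraticEisensteinDescentManinDatumSupercuspidalCMInertTorsionCoreOfResolventBound
  (val_sum_pow_le val_add_pow_le inv_sub_eq_geom)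
open Summit.BirchSwinnertonDyer.BirchSwinnertonDyer.Theorems.BiquadraticEisensteinDescentManinDatumSupercuspidalCMInertFiveDivisionEisensteinJZero
  (varpiRho_pos val_weierstrassP_five_div_rho)
open Summit.BirchSwinnertonDyer.BirchSwinnertonDyer.Theorems.BiquadraticEisensteinDescentManinDatumSupercuspidalCMInertTorsionCoordinatesJZero
  (torsion_coord_isIntegral_rho val_normalized_le_one_of_torsion_rho five_mul_divPointRho_mem divPointRho_notMem)

/-! ## §1 The valuation bound from the resolvent bound (generic) -/

/-- ★ **Expansion: the resolvent bound controls the pole sum.** `v` a valuation of `ℂ`, `q ∈ ℂ` with `v q < 1`, `N ≠ 0`, `d ≤ N` (any `e`);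
`v X ≤ 1`, `v Y ≤ 1`; weights `Φ_i` with `v Φ_i ≤ 1`; poles `X_i` with `X_i ≠ 0` and `v(X_i⁻¹)^e = v q` whenever `Φ_i ≠ 0`. If
`v(Σ_i Φ_i·X_i⁻ⁿ)^N ≤ v(q)^d` for every `n ≥ 1`, then `v(Y·Σ_i Φ_i/(X − X_i))^N ≤ v(q)^d`. [cite: Serre1979, Ch. IV §2 Prop. 7] -/
theorem val_mul_sum_div_sub_pow_le_of_resolventBound {Γ₀ : Type*} [LinearOrderedCommGroupWithZero Γ₀] (v : Valuation ℂ Γ₀)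
    {q : ℂ} (hq : v q < 1) {e N d : ℕ} (hN : N ≠ 0) (hdN : d ≤ N)
    {ι : Type*} [Fintype ι] (Φ : ι → ℂ) (hΦv : ∀ i, v (Φ i) ≤ 1)
    (Xt : ι → ℂ) (hXt : ∀ i, Φ i ≠ 0 → Xt i ≠ 0 ∧ v (Xt i)⁻¹ ^ e = v q)
    {Xw Yw : ℂ} (hXw : v Xw ≤ 1) (hYw : v Yw ≤ 1)
    (hRES : ∀ n : ℕ, 1 ≤ n → v (∑ i, Φ i * (Xt i)⁻¹ ^ n) ^ N ≤ v q ^ d) :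
    v (Yw * ∑ i, Φ i / (Xw - Xt i)) ^ N ≤ v q ^ d := by
  have hq1 : v q ≤ 1 := hq.le
  have hBN : v q ^ N ≤ v q ^ d := pow_le_pow_right_of_le_one' hq1 hdN
  -- per index with `Φ i ≠ 0`: `X_i ≠ 0`, `v(π_i)^e = v q`, `v π_i < 1 < v X_i`, `Xw ≠ X_i`, `v (Xw − X_i) = v X_i`
  have hcls : ∀ i, Φ i ≠ 0 → Xt i ≠ 0 ∧ v (Xt i)⁻¹ ^ e = v q ∧ v (Xt i)⁻¹ < 1 ∧ Xw ≠ Xt i ∧ v (Xw - Xt i) = v (Xt i) := by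
    intro i hi
    obtain ⟨hX0, hvX⟩ := hXt i hi
    have hπ1 : v (Xt i)⁻¹ < 1 := by
      by_contra hge
      push Not at hge
      have : (1 : Γ₀) ≤ v (Xt i)⁻¹ ^ e := one_le_pow₀ hge
      rw [hvX] at this
      exact absurd hq (not_lt.mpr this)
    have hvXpos : 0 < v (Xt i) := lt_of_le_of_ne zero_le (Ne.symm ((Valuation.ne_zero_iff v).mpr hX0))
    have hXbig : 1 < v (Xt i) := by
      have h := hπ1
      rw [map_inv₀] at h
      exact (inv_lt_one₀ hvXpos).mp h
    have hne : Xw ≠ Xt i := by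
      intro h
      rw [h] at hXw
      exact absurd hXbig (not_lt.mpr hXw)
    have hvsub : v (Xw - Xt i) = v (Xt i) := by
      rw [sub_eq_add_neg, add_comm, Valuation.map_add_eq_of_lt_left]
      · rw [Valuation.map_neg]
      · rw [Valuation.map_neg]; exact lt_of_le_of_lt hXw hXbig
    exact ⟨hX0, hvX, hπ1, hne, hvsub⟩
  -- the termwise expansion (both sides vanish when `Φ i = 0`)
  have hexp : ∀ i, Φ i / (Xw - Xt i) =
      -(∑ n ∈ Finset.range e, Φ i * (Xw ^ n * (Xt i)⁻¹ ^ (n + 1))) +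
        Φ i * ((Xw * (Xt i)⁻¹) ^ e / (Xw - Xt i)) := by
    intro i
    by_cases hi : Φ i = 0
    · rw [hi]; simp
    · obtain ⟨hX0, -, -, hne, -⟩ := hcls i hi
      have h := inv_sub_eq_geom hX0 hne e
      rw [div_eq_mul_one_div (Φ i), h, ← Finset.mul_sum]
      ring
  have hsum : ∑ i, Φ i / (Xw - Xt i) =
      -(∑ n ∈ Finset.range e, Xw ^ n * ∑ i, Φ i * (Xt i)⁻¹ ^ (n + 1)) +
        ∑ i, Φ i * ((Xw * (Xt i)⁻¹) ^ e / (Xw - Xt i)) := by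
    rw [Finset.sum_congr rfl (fun i _ ↦ hexp i), Finset.sum_add_distrib, Finset.sum_neg_distrib, Finset.sum_comm]
    congr 2
    refine Finset.sum_congr rfl fun n _ ↦ ?_
    rw [Finset.mul_sum]
    refine Finset.sum_congr rfl fun i _ ↦ ?_
    ring
  -- bounds
  have hmain : ∀ n ∈ Finset.range e, v (Xw ^ n * ∑ i, Φ i * (Xt i)⁻¹ ^ (n + 1)) ^ N ≤ v q ^ d := by
    intro n _
    rw [Valuation.map_mul, mul_pow, Valuation.map_pow]
    have h1 : (v Xw ^ n) ^ N ≤ 1 := pow_le_one₀ zero_le (pow_le_one₀ zero_le hXw)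
    exact le_trans (mul_le_of_le_one_left zero_le h1) (hRES (n + 1) (by omega))
  have htail : ∀ i ∈ (Finset.univ : Finset ι), v (Φ i * ((Xw * (Xt i)⁻¹) ^ e / (Xw - Xt i))) ^ N ≤ v q ^ d := by
    intro i _
    by_cases hi : Φ i = 0
    · rw [hi, zero_mul, Valuation.map_zero, zero_pow hN]; exact zero_le
    · obtain ⟨hX0, hvX, hπ1, hne, hvsub⟩ := hcls i hi
      -- `v(term) = v Φ · v Xw ^ e · v q · v π ≤ v q`
      have hterm : v (Φ i * ((Xw * (Xt i)⁻¹) ^ e / (Xw - Xt i))) ≤ v q := by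
        rw [Valuation.map_mul, map_div₀, Valuation.map_pow, Valuation.map_mul, mul_pow, hvsub, hvX]
        have hq' : v Xw ^ e * v q / v (Xt i) = v Xw ^ e * v q * v (Xt i)⁻¹ := by
          rw [map_inv₀, div_eq_mul_inv]
        rw [hq']
        have h1 : v (Φ i) * (v Xw ^ e * v q * v (Xt i)⁻¹) ≤ 1 * (1 * v q * 1) :=
          mul_le_mul' (hΦv i) (mul_le_mul' (mul_le_mul' (pow_le_one₀ zero_le hXw) le_rfl) hπ1.le)
        simpa using h1
      exact le_trans (pow_le_pow_left₀ zero_le hterm N) hBN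
  have hS : v (∑ i, Φ i / (Xw - Xt i)) ^ N ≤ v q ^ d := by
    rw [hsum]
    refine val_add_pow_le v ?_ (val_sum_pow_le v _ _ hN htail)
    rw [Valuation.map_neg]
    exact val_sum_pow_le v _ _ hN hmain
  rw [Valuation.map_mul, mul_pow]
  exact le_trans (mul_le_of_le_one_left zero_le (pow_le_one₀ zero_le hYw)) hS

/-! ## §2 Packaging in the `p ∤ s` currency from algebraicity -/

/-- Finite sums of algebraic numbers are algebraic. [folklore] -/
theorem isAlgebraic_sum {ι : Type*} (s : Finset ι) (f : ι → ℂ) (hf : ∀ i ∈ s, IsAlgebraic ℤ (f i)) :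
    IsAlgebraic ℤ (∑ i ∈ s, f i) := by
  induction s using Finset.induction_on with
  | empty => simpa using isAlgebraic_zero
  | insert a s ha ih =>
    rw [Finset.sum_insert ha]
    exact (hf a (Finset.mem_insert_self a s)).add (ih fun i hi ↦ hf i (Finset.mem_insert_of_mem hi))

/-- An algebraic integer is algebraic; so is its quotient by a non-zero natural number, and a natural number itself. [folklore] -/
theorem isAlgebraic_of_isIntegral_natCast_pow_mul {z : ℂ} {n k : ℕ} (hn : n ≠ 0) (hz : IsIntegral ℤ ((n : ℂ) ^ k * z)) :
    IsAlgebraic ℤ z := by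
  have h1 : IsAlgebraic ℤ ((n : ℂ) ^ k * z) := hz.isAlgebraic
  have h2 : IsAlgebraic ℤ (((n : ℂ) ^ k)⁻¹) := by
    refine IsAlgebraic.inv ?_
    have : IsIntegral ℤ ((n : ℂ) ^ k) := by
      simpa using (isIntegral_algebraMap (R := ℤ) (A := ℂ) (x := (n : ℤ))).pow k
    exact this.isAlgebraic
  have e : z = ((n : ℂ) ^ k)⁻¹ * ((n : ℂ) ^ k * z) := by
    rw [← mul_assoc, inv_mul_cancel₀ (pow_ne_zero _ (Nat.cast_ne_zero.mpr hn)), one_mul]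
  rw [e]
  exact h2.mul h1

/-- ★ **Valuations to the `p ∤ s` currency, for algebraic numbers.** `p` prime, `z ∈ ℂ` ALGEBRAIC, and `v z ≤ 1` for every valuation `v` of
`ℂ` with `v p < 1` ⇒ `∃ s ∈ ℕ`, `p ∤ s`, `s·z ∈ ℤ̄` (take `m ≠ 0` with `m z ∈ ℤ̄`, `m = ±pᵃN` with `p ∤ N`; then `s = N` works by
`…SevenDivisionCurrency.exists_not_dvd_mul_isIntegral_of_forall_valuation`). [cite: ZariskiSamuel1960, Vol. II, Ch. VI §4, Thm. 6] -/
theorem exists_not_dvd_mul_isIntegral_of_isAlgebraic {p : ℕ} (hp : p.Prime) {z : ℂ} (hz : IsAlgebraic ℤ z)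
    (hval : ∀ (Γ₀ : Type) [LinearOrderedCommGroupWithZero Γ₀] (v : Valuation ℂ Γ₀), v p < 1 → v z ≤ 1) :
    ∃ s : ℕ, ¬ p ∣ s ∧ IsIntegral ℤ ((s : ℂ) * z) := by
  obtain ⟨m, hm0, hmz⟩ := hz.exists_integral_multiple
  -- `|m| = p^a · N` with `p ∤ N`
  obtain ⟨M, hM⟩ := Int.eq_nat_or_neg m
  have hM0 : M ≠ 0 := by
    rintro rfl
    rcases hM with h | h <;> exact hm0 (by simpa using h)
  obtain ⟨a, N, hN, hMN⟩ := Nat.exists_eq_pow_mul_and_not_dvd hM0 p hp.ne_one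
  have hMz : IsIntegral ℤ ((M : ℂ) * z) := by
    rcases hM with rfl | rfl
    · simpa [zsmul_eq_mul] using hmz
    · simpa [zsmul_eq_mul] using hmz.neg
  have hint : IsIntegral ℤ ((p : ℂ) ^ a * ((N : ℂ) * z)) := by
    have : (p : ℂ) ^ a * ((N : ℂ) * z) = (M : ℂ) * z := by rw [hMN]; push_cast; ring
    rw [this]; exact hMz
  exact exists_not_dvd_mul_isIntegral_of_forall_valuation hp hN hint hval

/-! ## §3 The `j = 0` cell: `ℤρ + ℤ`, `y² = x³ − 1`, `p = 5`, `e = 12`, `N = 6` -/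

/-- **The valuation bound from the resolvent bound, `j = 0`.** `w` a prime-to-`5` torsion point (`w ∉ Λ = ℤρ + ℤ`, `M′w ∈ Λ`, `(M′, 5) = 1`),
`t_d = (d₁ρ + d₂)/5` the `5`-division points, `Φ 0 = 0`, `v(Φ d) ≤ 1`; `X = ℘/ϖ₁²`, `Y = ℘′/(2ϖ₁³)`, `k ≤ 6`. For a valuation `v` of `ℂ` with
`v 5 < 1`: if `v(Σ_d Φ(d)·X(t_d)⁻ⁿ)⁶ ≤ v(5)^{6−k}` for all `n ≥ 1`, then `v(Y(w)·Σ_d Φ(d)/(X(w) − X(t_d)))⁶ ≤ v(5)^{6−k}`.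
[cite: Serre1979, Ch. IV §2 Prop. 7] -/
theorem val_coreSum_pow_six_le_rho {Γ₀ : Type*} [LinearOrderedCommGroupWithZero Γ₀] (v : Valuation ℂ Γ₀) (h5 : v 5 < 1)
    {k : ℕ} (hk : k ≤ 6) (Φ : ZMod 5 × ZMod 5 → ℂ) (hΦ0 : Φ 0 = 0) (hΦv : ∀ d, v (Φ d) ≤ 1)
    {w : ℂ} {M' : ℕ} (hw : w ∉ (ofUpperHalfPlane UpperHalfPlane.ρ).lattice)
    (hMw : ((M' : ℂ) * w) ∈ (ofUpperHalfPlane UpperHalfPlane.ρ).lattice) (hM5 : Nat.Coprime M' 5)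
    (hRES : ∀ n : ℕ, 1 ≤ n →
      v (∑ d : ZMod 5 × ZMod 5, Φ d *
        (℘[ofUpperHalfPlane UpperHalfPlane.ρ] (((d.1.val : ℂ) * UpperHalfPlane.ρ + (d.2.val : ℂ)) / 5) /
          (((2 : ℝ) ^ (2 / 3 : ℝ) * Real.Gamma (1 / 3) ^ 3 / (4 * Real.pi) : ℝ) : ℂ) ^ 2)⁻¹ ^ n) ^ 6 ≤ v 5 ^ (6 - k)) :
    v (℘'[ofUpperHalfPlane UpperHalfPlane.ρ] w / (2 * (((2 : ℝ) ^ (2 / 3 : ℝ) * Real.Gamma (1 / 3) ^ 3 / (4 * Real.pi) : ℝ) : ℂ) ^ 3) *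
      ∑ d : ZMod 5 × ZMod 5, Φ d /
        (℘[ofUpperHalfPlane UpperHalfPlane.ρ] w / (((2 : ℝ) ^ (2 / 3 : ℝ) * Real.Gamma (1 / 3) ^ 3 / (4 * Real.pi) : ℝ) : ℂ) ^ 2 -
          ℘[ofUpperHalfPlane UpperHalfPlane.ρ] (((d.1.val : ℂ) * UpperHalfPlane.ρ + (d.2.val : ℂ)) / 5) /
            (((2 : ℝ) ^ (2 / 3 : ℝ) * Real.Gamma (1 / 3) ^ 3 / (4 * Real.pi) : ℝ) : ℂ) ^ 2)) ^ 6
      ≤ v 5 ^ (6 - k) := by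
  obtain ⟨hXw, hYw⟩ := val_normalized_le_one_of_torsion_rho v h5 hw hMw hM5
  refine val_mul_sum_div_sub_pow_le_of_resolventBound v h5 (e := 12) (N := 6) (d := 6 - k) (by norm_num) (by omega)
    Φ hΦv _ (fun d hd ↦ ?_) hXw hYw hRES
  have hd0 : d ≠ 0 := by rintro rfl; exact hd hΦ0
  obtain ⟨hX0, -, hvX, -⟩ := val_weierstrassP_five_div_rho v h5 (divPointRho_notMem hd0) (five_mul_divPointRho_mem d)
  exact ⟨hX0, hvX⟩

/-- `5^{k/6} · 5^{(6−k)/6} = 5` for `k ≤ 6`. [folklore] -/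
theorem cpow_sixth_mul_cpow_sixth_of_le {k : ℕ} (hk : k ≤ 6) :
    (5 : ℂ) ^ ((k : ℂ) / 6) * (5 : ℂ) ^ (((6 - k : ℕ) : ℂ) / 6) = 5 := by
  rw [← Complex.cpow_add _ _ (by norm_num : (5 : ℂ) ≠ 0), Nat.cast_sub hk,
    show (k : ℂ) / 6 + ((6 : ℕ) - (k : ℂ)) / 6 = 1 by push_cast; ring, Complex.cpow_one]

/-- ★ **The termwise core statement from the resolvent bound, `j = 0`.** `w ∉ Λ = ℤρ + ℤ`, `M′w ∈ Λ`, `(M′, 5) = 1`; `Φ : (ℤ/5)² → ℂ` with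
`Φ 0 = 0` and algebraic-integer values; `t_d = (d₁ρ + d₂)/5`; `1 ≤ k ≤ 5`. If for EVERY valuation `v` of `ℂ` with `v 5 < 1` and every `n ≥ 1`
the resolvent bound `v(Σ_d Φ(d)·X(t_d)⁻ⁿ)⁶ ≤ v(5)^{6−k}` holds, then `∃ s ∈ ℕ, 5 ∤ s, s·(Y(w)·Σ_d Φ(d)/(X(w) − X(t_d)))/5^{(6−k)/6} ∈ ℤ̄`.
[cite: Serre1979, Ch. IV §2 Prop. 7] [cite: ZariskiSamuel1960, Vol. II, Ch. VI §4, Thm. 6] -/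
theorem coreSum_integral_of_resolventBound_rho {k : ℕ} (hk1 : 1 ≤ k) (hk5 : k ≤ 5)
    (Φ : ZMod 5 × ZMod 5 → ℂ) (hΦ0 : Φ 0 = 0) (hΦint : ∀ d, IsIntegral ℤ (Φ d))
    {w : ℂ} {M' : ℕ} (hw : w ∉ (ofUpperHalfPlane UpperHalfPlane.ρ).lattice)
    (hMw : ((M' : ℂ) * w) ∈ (ofUpperHalfPlane UpperHalfPlane.ρ).lattice) (hM5 : Nat.Coprime M' 5)
    (hRES : ∀ n : ℕ, 1 ≤ n → ∀ (Γ₀ : Type) [LinearOrderedCommGroupWithZero Γ₀] (v : Valuation ℂ Γ₀), v 5 < 1 →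
      v (∑ d : ZMod 5 × ZMod 5, Φ d *
        (℘[ofUpperHalfPlane UpperHalfPlane.ρ] (((d.1.val : ℂ) * UpperHalfPlane.ρ + (d.2.val : ℂ)) / 5) /
          (((2 : ℝ) ^ (2 / 3 : ℝ) * Real.Gamma (1 / 3) ^ 3 / (4 * Real.pi) : ℝ) : ℂ) ^ 2)⁻¹ ^ n) ^ 6 ≤ v 5 ^ (6 - k)) :
    ∃ s : ℕ, ¬ 5 ∣ s ∧ IsIntegral ℤ ((s : ℂ) *
      ((℘'[ofUpperHalfPlane UpperHalfPlane.ρ] w / (2 * (((2 : ℝ) ^ (2 / 3 : ℝ) * Real.Gamma (1 / 3) ^ 3 / (4 * Real.pi) : ℝ) : ℂ) ^ 3) *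
        ∑ d : ZMod 5 × ZMod 5, Φ d /
          (℘[ofUpperHalfPlane UpperHalfPlane.ρ] w / (((2 : ℝ) ^ (2 / 3 : ℝ) * Real.Gamma (1 / 3) ^ 3 / (4 * Real.pi) : ℝ) : ℂ) ^ 2 -
            ℘[ofUpperHalfPlane UpperHalfPlane.ρ] (((d.1.val : ℂ) * UpperHalfPlane.ρ + (d.2.val : ℂ)) / 5) /
              (((2 : ℝ) ^ (2 / 3 : ℝ) * Real.Gamma (1 / 3) ^ 3 / (4 * Real.pi) : ℝ) : ℂ) ^ 2)) /
        (5 : ℂ) ^ (((6 - k : ℕ) : ℂ) / 6))) := by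
  have hM0 : M' ≠ 0 := by rintro rfl; exact absurd hM5 (by decide)
  -- algebraicity facts first, then name the coordinates
  obtain ⟨hXint, hYint⟩ := torsion_coord_isIntegral_rho hw hMw hM0
  have hXt_int : ∀ d : ZMod 5 × ZMod 5, d ≠ 0 → IsIntegral ℤ (((5 : ℕ) : ℂ) ^ 2 *
      (℘[ofUpperHalfPlane UpperHalfPlane.ρ] (((d.1.val : ℂ) * UpperHalfPlane.ρ + (d.2.val : ℂ)) / 5) /
        (((2 : ℝ) ^ (2 / 3 : ℝ) * Real.Gamma (1 / 3) ^ 3 / (4 * Real.pi) : ℝ) : ℂ) ^ 2)) := fun d hd ↦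
    (torsion_coord_isIntegral_rho (n := 5) (divPointRho_notMem hd) (by exact_mod_cast five_mul_divPointRho_mem d) (by norm_num)).1
  have hvalw := fun (Γ₀ : Type) [LinearOrderedCommGroupWithZero Γ₀] (v : Valuation ℂ Γ₀) (hv : v 5 < 1) ↦
    val_coreSum_pow_six_le_rho v hv (show k ≤ 6 by omega) Φ hΦ0 (fun d ↦ val_le_one_of_isIntegral v (hΦint d)) hw hMw hM5
      (fun n hn ↦ hRES n hn Γ₀ v hv)
  set ϖ : ℂ := (((2 : ℝ) ^ (2 / 3 : ℝ) * Real.Gamma (1 / 3) ^ 3 / (4 * Real.pi) : ℝ) : ℂ) with hϖ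
  set Xw : ℂ := ℘[ofUpperHalfPlane UpperHalfPlane.ρ] w / ϖ ^ 2 with hXwdef
  set Yw : ℂ := ℘'[ofUpperHalfPlane UpperHalfPlane.ρ] w / (2 * ϖ ^ 3) with hYwdef
  set Xt : ZMod 5 × ZMod 5 → ℂ := fun d ↦
    ℘[ofUpperHalfPlane UpperHalfPlane.ρ] (((d.1.val : ℂ) * UpperHalfPlane.ρ + (d.2.val : ℂ)) / 5) / ϖ ^ 2 with hXtdef
  set S : ℂ := ∑ d : ZMod 5 × ZMod 5, Φ d / (Xw - Xt d) with hSdef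
  set ρ : ℂ := (5 : ℂ) ^ (((6 - k : ℕ) : ℂ) / 6) with hρ
  set τ : ℂ := (5 : ℂ) ^ ((k : ℂ) / 6) with hτ
  have hτρ : τ * ρ = 5 := cpow_sixth_mul_cpow_sixth_of_le (by omega)
  have hρ0 : ρ ≠ 0 := by
    intro h; have := (Complex.cpow_eq_zero_iff _ _).mp h; norm_num at this
  have hρ6 : ρ ^ 6 = 5 ^ (6 - k) := by
    rw [hρ, ← Complex.cpow_nat_mul, show ((6 : ℕ) : ℂ) * ((((6 - k : ℕ)) : ℂ) / 6) = ((6 - k : ℕ) : ℂ) by push_cast; ring,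
      Complex.cpow_natCast]
  have hτint : IsIntegral ℤ τ := by
    refine IsIntegral.of_pow (n := 6) (by norm_num) ?_
    rw [hτ, ← Complex.cpow_nat_mul, show ((6 : ℕ) : ℂ) * ((k : ℂ) / 6) = ((k : ℕ) : ℂ) by push_cast; ring, Complex.cpow_natCast]
    simpa using (isIntegral_algebraMap (R := ℤ) (A := ℂ) (x := (5 : ℤ))).pow k
  -- (α) `z₀ := Yw · S / ρ = Yw · S · τ / 5` is algebraic
  have hXw_alg : IsAlgebraic ℤ Xw := isAlgebraic_of_isIntegral_natCast_pow_mul (k := 2) hM0 hXint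
  have hYw_alg : IsAlgebraic ℤ Yw := isAlgebraic_of_isIntegral_natCast_pow_mul (k := 3) hM0 hYint
  have hterm_alg : ∀ d : ZMod 5 × ZMod 5, IsAlgebraic ℤ (Φ d / (Xw - Xt d)) := by
    intro d
    by_cases hd : d = 0
    · rw [hd, hΦ0, zero_div]; exact isAlgebraic_zero
    · have hXt_alg : IsAlgebraic ℤ (Xt d) := isAlgebraic_of_isIntegral_natCast_pow_mul (k := 2) (by norm_num) (hXt_int d hd)
      rw [div_eq_mul_inv]
      exact (hΦint d).isAlgebraic.mul (hXw_alg.sub hXt_alg).inv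
  have hS_alg : IsAlgebraic ℤ S := isAlgebraic_sum _ _ fun d _ ↦ hterm_alg d
  set z₀ : ℂ := (Yw * S) / ρ with hz₀
  have hz₀_alg : IsAlgebraic ℤ z₀ := by
    have e : z₀ = Yw * S * τ * (((5 : ℕ) : ℂ) ^ 1)⁻¹ := by
      rw [hz₀, div_eq_iff hρ0]
      have h5 : (5 : ℂ) = τ * ρ := hτρ.symm
      push_cast
      field_simp
      rw [h5]; ring
    rw [e]
    have h5inv : IsAlgebraic ℤ ((((5 : ℕ) : ℂ) ^ 1)⁻¹) := by
      refine IsAlgebraic.inv ?_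
      simpa using ((isIntegral_algebraMap (R := ℤ) (A := ℂ) (x := (5 : ℤ))).pow 1).isAlgebraic
    exact ((hYw_alg.mul hS_alg).mul hτint.isAlgebraic).mul h5inv
  -- (β) `v z₀ ≤ 1` at every `v ∣ 5`
  have hval : ∀ (Γ₀ : Type) [LinearOrderedCommGroupWithZero Γ₀] (v : Valuation ℂ Γ₀), v 5 < 1 → v z₀ ≤ 1 := by
    intro Γ₀ _ v hv
    have h6 : v (Yw * S) ^ 6 ≤ v 5 ^ (6 - k) := hvalw Γ₀ v hv
    have hρv : v ρ ^ 6 = v 5 ^ (6 - k) := by rw [← Valuation.map_pow, hρ6, Valuation.map_pow]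
    rw [← hρv] at h6
    have hle : v (Yw * S) ≤ v ρ := le_of_pow_le_pow_left₀ (by norm_num) zero_le h6
    rw [hz₀, map_div₀]
    exact div_le_one_of_le₀ hle zero_le
  obtain ⟨s, hs, hsint⟩ := exists_not_dvd_mul_isIntegral_of_isAlgebraic (p := 5) (by norm_num) hz₀_alg hval
  exact ⟨s, hs, by rw [hz₀] at hsint; exact hsint⟩

end Summit.BirchSwinnertonDyer.BirchSwinnertonDyer.Theorems.BiquadraticEisensteinDescentManinDatumSupercuspidalCMInertTorsionCoreOfResolventBoundJZero

end
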